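/-
Copyright: lit-balaban cell (HOME `run/shared/lean/pub/lit-balaban/`), Phase-2 proof seat p12 (gen 10).  The proofs are
kernel-checked; nothing is claimed beyond what the kernel checks below.
-/
import Literature.MathematicalPhysics.QuantumFieldTheory.DybalskiStottmeisterTanimoto2024.DST24FinitePropagation
import Literature.MathematicalPhysics.QuantumFieldTheory.DybalskiStottmeisterTanimoto2024.DST24MainTheorem

/-!
# `DybalskiStottmeisterTanimoto2024.DST24InftyBounds` — [DybalskiStottmeisterTanimoto2024] **§4.5 Lemma (infty-bounds) PROVED**
# («`‖Γ‖_{∞,∞;Ω} ≤ C`, `‖(QΓQ*)⁻¹‖_{∞,∞;Ω₁} ≤ C` for `C` independent of `n`») **and THEOREM 1 (§1.1) DISCHARGED**: `Theorem1_holds`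

statement-level skeleton of published theorems with citation tags; proofs where landed; nothing here is a claim about
the Yang–Mills mass gap

W. Dybalski, A. Stottmeister, Y. Tanimoto, *The Bałaban variational problem in the non-linear sigma model*, Rev. Math. Phys.
**36** (2024), arXiv:2403.09800; source held `paper:arxiv-2403.09800` (§4.5 = tex chunk p0015 «\bel The following bounds hold true
`‖Γ‖_{∞,∞;Ω} ≤ C`, `‖(QΓQ*)⁻¹‖_{∞,∞;Ω₁} ≤ C`, for `C` independent of `n`. \eel  \proof For `M = Γ` we immediately obtain the bound
referring to (norm-estimate-zero) and the decay of the kernel (Green-function-Neumann). For `N = (QΓQ*)⁻¹` we use (norm-estimate) and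
(Green-function-inverse-Neumann). \qed»).  Unit `lit-balaban-p12` (gen 10); the typed Theorem 1 is `DST24Setting.Theorem1`, its
reduction to Lemma (infty-bounds) is `DST24MainTheorem.theorem1_of_infty_bounds` (p12 gen 7).

THE ROAD TAKEN (deviation from the printed proof, declared).  The printed proof of Lemma (infty-bounds) rests on the kernel decay
of §4.3 (random-walk expansion of [DST23], Appendix A) and the method of images of §4.4.  Here both bounds are derived from the
§4.2 `𝓛²` facts already in the tree by the transfer theorem `DST24FinitePropagation.norm_le_of_apply_eq` (an `𝓛²`-coercive,
`𝓛²`-bounded, finite-range operator has a volume-uniform `𝓛^∞` a-priori bound for `Mu = f`):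
* `Γ`: `M = −Δ_Ω + Q*Q` is coercive with `σ = (8L⁴)⁻¹` ((many-boxes) `DST24GreenFunction.many_boxes`), bounded with `Λ₂ = 130`
  (`DST24LaplacianBounds.ipS_Mfun_Mfun_le`) and has range `1` in the block distance (`hasRange_Mop`: `∂*∂` couples neighbouring
  boxes, `Q*Q` stays in a box) ⇒ `‖Γf‖_{∞;Ω} ≤ C_Γ(L)‖f‖_{∞;Ω}` with `C_Γ(L) = supConst L (8L⁴)⁻¹ 130 1` (`norm_Gamma_le`).
* `(QΓQ*)⁻¹`: with `A = ∂*∂`, `P = Q*Q`, `R = 1 − P` and the auxiliary `K := RAR + P` (again coercive `σ = (8L⁴)⁻¹` by the box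
  Poincaré inequality (unit-box) on `ker Q`, bounded by `130`, range `1`; `ipS_Kop_ge`, `ipS_Kop_Kop_le`, `hasRange_Kop`) one has the
  Schur-complement identity `(QΓQ*)⁻¹g = g + QA(Q*g − K⁻¹RAQ*g)` (`QGammaQstar_symm_eq`: for `w = K⁻¹RAQ*g`, `Pw = 0`, so
  `f := Q*g − w` has `Qf = g` and `(−Δ_Ω + Q*Q)f = Q*(g + QAf)`), whence `‖(QΓQ*)⁻¹g‖_{∞;Ω₁} ≤ (9 + 128·C_Γ(L))‖g‖_{∞;Ω₁}`
  (`norm_QGammaQstar_symm_le`) from `‖Q‖,‖Q*‖ ≤ 1` (`DST24MainTheorem.norm_Q_le/norm_Qstar_le`), `‖∂*∂‖_{∞,∞} ≤ 8` (`norm_Aop_le`,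
  via (lap-2) `DST24RemainderBounds.norm_delStar_le_four_mul`) and the transfer theorem for `K` (`norm_Kinv_le`).
The constants are explicit polynomials in `L` and independent of `n₁`, as printed («may depend on `L`», Theorem 1).

WHAT IS HERE.  `blkDist_src_tgt_le_one` (bond endpoints lie in boxes at label distance `≤ 1`), `hasRange_Aop`/`hasRange_Pop`/
`hasRange_Mop`/`hasRange_Kop`; the operators `Aop = ∂*∂`, `Pop = Q*Q`, `Rop = 1 − Q*Q`, `Kop = RAR + P` as linear maps with their `𝓛²`
and `𝓛^∞` bounds (`Q_sub` is `DST24MainTheorem.Q_sub`); `CGamma`, `norm_Gamma_le` (**first bound of Lemma (infty-bounds)**); `Kop_injective`, `Kinv`, `norm_Kinv_le`;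
`QGammaQstar_symm_eq`, `CQinv`, `norm_QGammaQstar_symm_le` (**second bound**); `infty_bounds` (the Lemma as printed, both bounds,
uniform in `n₁`); **`Theorem1_holds : ∀ L, DST24Setting.Theorem1 L`** (Theorem 1 of the paper, now a theorem of the tree).
-/

namespace Literature.MathematicalPhysics.QuantumFieldTheory.DybalskiStottmeisterTanimoto2024.DST24InftyBounds

open scoped RealInnerProductSpace BigOperators
open Literature.MathematicalPhysics.QuantumFieldTheory.Federbush1986
open Literature.MathematicalPhysics.QuantumFieldTheory.DybalskiStottmeisterTanimoto2024.DST24Setting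
open Literature.MathematicalPhysics.QuantumFieldTheory.DybalskiStottmeisterTanimoto2024.DST24LinearConstraint
open Literature.MathematicalPhysics.QuantumFieldTheory.DybalskiStottmeisterTanimoto2024.DST24CriticalPoint
open Literature.MathematicalPhysics.QuantumFieldTheory.DybalskiStottmeisterTanimoto2024.DST24GreenFunction
open Literature.MathematicalPhysics.QuantumFieldTheory.DybalskiStottmeisterTanimoto2024.DST24LaplacianBounds
open Literature.MathematicalPhysics.QuantumFieldTheory.DybalskiStottmeisterTanimoto2024.DST24RemainderBounds
open Literature.MathematicalPhysics.QuantumFieldTheory.DybalskiStottmeisterTanimoto2024.DST24FinitePropagation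
open Literature.MathematicalPhysics.QuantumFieldTheory.DybalskiStottmeisterTanimoto2024.DST24MainTheorem

noncomputable section

variable {L n₁ : ℕ}

/-! ## Bonds join boxes at label distance `≤ 1`; the ranges of `∂*∂`, `Q*Q`, `−Δ_Ω + Q*Q` -/

/-- `⌊a/L⌋` and `⌊(a+1)/L⌋` differ by at most one. [cite: DybalskiStottmeisterTanimoto2024, §1.1 (y_x)] -/
theorem div_dist_succ_div_le_one (hL : 0 < L) (a : ℕ) : (a / L).dist ((a + 1) / L) ≤ 1 := by
  have h1 : a / L ≤ (a + 1) / L := Nat.div_le_div_right (by omega)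
  have h2 : (a + 1) / L ≤ (a + L) / L := Nat.div_le_div_right (by omega)
  have h3 : (a + L) / L = a / L + 1 := Nat.add_div_right a hL
  unfold Nat.dist
  omega

/-- The endpoints `b₋, b₊` of a bond lie in boxes whose labels are at sup-distance `≤ 1`. [cite: DybalskiStottmeisterTanimoto2024, §1.1 (Ω′, B₁(y)); §4.2 («bonds linking different boxes»)] -/
theorem blkDist_src_tgt_le_one (hL : 0 < L) (b : Bond L n₁) : blkDist b.src b.tgt ≤ 1 := by
  rw [blkDist_eq]
  refine cDist_le_iff.mpr fun μ => ?_
  rw [blk_apply, blk_apply]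
  by_cases hμ : μ = b.dir
  · rw [hμ, b.tgt_apply_dir]; exact div_dist_succ_div_le_one hL _
  · rw [b.tgt_apply_of_ne hμ, Nat.dist_self]; exact Nat.zero_le _

section Operators

variable {E : Type*} [NormedAddCommGroup E] [InnerProductSpace ℝ E]

/-- `A := ∂*∂ = −Δ_Ω` as a linear map on `𝓛²(Ω; E)`. [cite: DybalskiStottmeisterTanimoto2024, §3.3 (Laplacian)] -/
def Aop : (Site L n₁ → E) →ₗ[ℝ] (Site L n₁ → E) where
  toFun f := delStar (del f)
  map_add' f g := by rw [del_add, delStar_add]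
  map_smul' c f := by rw [del_smul, delStar_smul, RingHom.id_apply]

/-- [cite: DybalskiStottmeisterTanimoto2024, §3.3 (Laplacian)] -/
@[simp] theorem Aop_apply (f : Site L n₁ → E) : (Aop f : Site L n₁ → E) = delStar (del f) := rfl

/-- `P := Q*Q` (the projection on block-constant functions) as a linear map. [cite: DybalskiStottmeisterTanimoto2024, §2.1 (2.6)] -/
def Pop (L : ℕ) : (Site L n₁ → E) →ₗ[ℝ] (Site L n₁ → E) where
  toFun f := Qstar L (Q L f)
  map_add' f g := by rw [Q_add, Qstar_add]
  map_smul' c f := by rw [Q_smul, Qstar_smul, RingHom.id_apply]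

/-- [cite: DybalskiStottmeisterTanimoto2024, §2.1 (2.6)] -/
@[simp] theorem Pop_apply (f : Site L n₁ → E) : (Pop L f : Site L n₁ → E) = Qstar L (Q L f) := rfl

/-- `R := 1 − Q*Q` (the complementary projection, onto `ker Q`). [cite: DybalskiStottmeisterTanimoto2024, §2.1 (2.6)] -/
def Rop (L : ℕ) : (Site L n₁ → E) →ₗ[ℝ] (Site L n₁ → E) := LinearMap.id - Pop L

/-- [cite: DybalskiStottmeisterTanimoto2024, §2.1 (2.6)] -/
theorem Rop_apply (f : Site L n₁ → E) : (Rop L f : Site L n₁ → E) = f - Qstar L (Q L f) := rfl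

/-- The auxiliary operator `K := RAR + P` (`= ∂*∂` compressed to `ker Q`, plus the identity on block constants): the Schur-complement
partner of `QΓQ*`. [cite: DybalskiStottmeisterTanimoto2024, §4.5 Lemma (infty-bounds) (second bound); §4.2 Lemma (inverse-lemma) 3.] -/
def Kop (L : ℕ) : (Site L n₁ → E) →ₗ[ℝ] (Site L n₁ → E) := (Rop L).comp (Aop.comp (Rop L)) + Pop L

/-- [cite: DybalskiStottmeisterTanimoto2024, §4.5 Lemma (infty-bounds)] -/
theorem Kop_apply (f : Site L n₁ → E) : (Kop L f : Site L n₁ → E) = Rop L (Aop (Rop L f)) + Pop L f := rfl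

/-- `∂*∂` has range `1` in the block distance. [cite: DybalskiStottmeisterTanimoto2024, §3.3 (adjoint) («`(∂*f)(x) = Σ_{b∋x} σ_b(x)f(b)`»)] -/
theorem hasRange_Aop (hL : 0 < L) : HasRange (⇑(Aop : (Site L n₁ → E) →ₗ[ℝ] (Site L n₁ → E))) 1 := by
  intro f g x hfg
  rw [Aop_apply, Aop_apply, delStar_apply, delStar_apply]
  congr 1
  · refine Finset.sum_congr rfl fun b _ => ?_
    split_ifs with h
    · rw [del_apply, del_apply, hfg b.src (by rw [h, blkDist_self]; exact Nat.zero_le _),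
        hfg b.tgt (by rw [← h]; exact blkDist_src_tgt_le_one hL b)]
    · rfl
  · refine Finset.sum_congr rfl fun b _ => ?_
    split_ifs with h
    · rw [del_apply, del_apply, hfg b.tgt (by rw [h, blkDist_self]; exact Nat.zero_le _),
        hfg b.src (by rw [← h, blkDist_comm]; exact blkDist_src_tgt_le_one hL b)]
    · rfl

/-- `Q*Q` has range `0` (it stays inside a box). [cite: DybalskiStottmeisterTanimoto2024, §2.1 (2.6) («`(Q*Qf)(x) = L⁻²Σ_{x′∈B(y_x)} f(x′)`»)] -/
theorem hasRange_Pop : HasRange (⇑(Pop L : (Site L n₁ → E) →ₗ[ℝ] (Site L n₁ → E))) 0 := by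
  intro f g x hfg
  rw [Pop_apply, Pop_apply, Qstar_Q_apply, Qstar_Q_apply]
  congr 1
  exact Finset.sum_congr rfl fun x' hx' => hfg x' (le_of_eq (blkDist_eq_zero_of_blk_eq (mem_box.mp hx').symm))

/-- `R = 1 − Q*Q` has range `0`. [cite: DybalskiStottmeisterTanimoto2024, §2.1 (2.6)] -/
theorem hasRange_Rop : HasRange (⇑(Rop L : (Site L n₁ → E) →ₗ[ℝ] (Site L n₁ → E))) 0 :=
  hasRange_id.sub hasRange_Pop

/-- `−Δ_Ω + Q*Q` has range `1`. [cite: DybalskiStottmeisterTanimoto2024, §3.3 (Green)] -/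
theorem hasRange_Mop (hL : 0 < L) : HasRange (⇑(Mop L : (Site L n₁ → E) →ₗ[ℝ] (Site L n₁ → E))) 1 := by
  have h := (hasRange_Aop (L := L) (n₁ := n₁) (E := E) hL).add (hasRange_Pop.mono (Nat.zero_le 1))
  intro f g x hfg
  exact h f g x hfg

/-- `K = RAR + P` has range `1`. [cite: DybalskiStottmeisterTanimoto2024, §4.5 Lemma (infty-bounds)] -/
theorem hasRange_Kop (hL : 0 < L) : HasRange (⇑(Kop L : (Site L n₁ → E) →ₗ[ℝ] (Site L n₁ → E))) 1 := by
  have h1 : HasRange (⇑(Rop L : (Site L n₁ → E) →ₗ[ℝ] _) ∘ (⇑(Aop : (Site L n₁ → E) →ₗ[ℝ] _) ∘ ⇑(Rop L))) 1 := by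
    have h := (hasRange_Rop (L := L) (n₁ := n₁) (E := E)).comp ((hasRange_Aop (L := L) (n₁ := n₁) (E := E) hL).comp hasRange_Rop)
    exact h.mono (by norm_num)
  have h := h1.add (hasRange_Pop.mono (Nat.zero_le 1))
  intro f g x hfg
  exact h f g x hfg

/-! ## `𝓛^∞` bounds of the building blocks -/

omit [InnerProductSpace ℝ E] in
/-- `‖∂f(b)‖ ≤ 2‖f‖_{∞;Ω}`. [cite: DybalskiStottmeisterTanimoto2024, §3.3 (derivative)] -/
theorem norm_del_le (f : Site L n₁ → E) (b : Bond L n₁) : ‖del f b‖ ≤ 2 * ‖f‖ := by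
  rw [del_apply]
  calc ‖f b.src - f b.tgt‖ ≤ ‖f b.src‖ + ‖f b.tgt‖ := norm_sub_le _ _
    _ ≤ ‖f‖ + ‖f‖ := add_le_add (norm_le_pi_norm f _) (norm_le_pi_norm f _)
    _ = 2 * ‖f‖ := by ring

/-- `‖∂*∂f‖_{∞;Ω} ≤ 8‖f‖_{∞;Ω}` ((lap-2): at most four bonds at a site). [cite: DybalskiStottmeisterTanimoto2024, §4.6 (lap-2); §4.2 (bounded-Laplacian)] -/
theorem norm_Aop_le (f : Site L n₁ → E) : ‖(Aop f : Site L n₁ → E)‖ ≤ 8 * ‖f‖ := by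
  refine (pi_norm_le_iff_of_nonneg (by positivity)).mpr fun x => ?_
  rw [Aop_apply]
  have h := norm_delStar_le_four_mul (del f) (M := 2 * ‖f‖) (by positivity) (norm_del_le f) x
  linarith

/-- `‖Q*Qf‖_{∞} ≤ ‖f‖_{∞}`. [cite: DybalskiStottmeisterTanimoto2024, §2.1 (2.6); §4.3 («`Q`, `Q*` on `𝓛^∞`»)] -/
theorem norm_Pop_le (hL : 0 < L) (f : Site L n₁ → E) : ‖(Pop L f : Site L n₁ → E)‖ ≤ ‖f‖ :=
  (norm_Qstar_le _).trans (norm_Q_le hL f)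

/-- `‖(1 − Q*Q)f‖_{∞} ≤ 2‖f‖_{∞}`. [cite: DybalskiStottmeisterTanimoto2024, §2.1 (2.6)] -/
theorem norm_Rop_le (hL : 0 < L) (f : Site L n₁ → E) : ‖(Rop L f : Site L n₁ → E)‖ ≤ 2 * ‖f‖ := by
  rw [Rop_apply]
  calc ‖f - Qstar L (Q L f)‖ ≤ ‖f‖ + ‖Qstar L (Q L f)‖ := norm_sub_le _ _
    _ ≤ ‖f‖ + ‖f‖ := add_le_add le_rfl (norm_Pop_le hL f)
    _ = 2 * ‖f‖ := by ring

/-! ## `𝓛²` facts: `P` is an orthogonal projection, `R = 1 − P`, coercivity and boundedness of `−Δ_Ω + Q*Q` and of `K` -/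

/-- `Q(1 − Q*Q) = 0` (since `QQ* = 1`). [cite: DybalskiStottmeisterTanimoto2024, §2.1 (2.6); §4.2 («`QQ* = 1`»)] -/
theorem Q_Rop (hL : 0 < L) (f : Site L n₁ → E) : Q L (Rop L f) = 0 := by
  rw [Rop_apply, Q_sub, Q_Qstar hL, sub_self]

/-- `P(1 − P) = 0`. [cite: DybalskiStottmeisterTanimoto2024, §2.1 (2.6)] -/
theorem Pop_Rop (hL : 0 < L) (f : Site L n₁ → E) : Pop L (Rop L f) = 0 := by
  rw [Pop_apply, Q_Rop hL]; rfl

/-- `⟨Q*Qf, Q*Qf⟩ = ⟨f, Q*Qf⟩`. [cite: DybalskiStottmeisterTanimoto2024, §2.1 (2.6)] -/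
theorem ipS_Pop_Pop (hL : 0 < L) (f : Site L n₁ → E) : ipS (Pop L f) (Pop L f) = ipS f (Pop L f) := by
  rw [Pop_apply, ← ipC_Q_eq_ipS_Qstar hL, ← ipC_Q_eq_ipS_Qstar hL, Q_Qstar hL]

/-- `⟨(1 − P)f, Pf⟩ = 0`. [cite: DybalskiStottmeisterTanimoto2024, §2.1 (2.6)] -/
theorem ipS_Rop_Pop (hL : 0 < L) (f : Site L n₁ → E) : ipS (Rop L f) (Pop L f) = 0 := by
  rw [Rop_apply, ipS_sub_left, ← Pop_apply, ipS_Pop_Pop hL, sub_self]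

/-- Pythagoras: `⟨f,f⟩ = ⟨Rf,Rf⟩ + ⟨Pf,Pf⟩`. [cite: DybalskiStottmeisterTanimoto2024, §2.1 (2.6)] -/
theorem ipS_eq_Rop_add_Pop (hL : 0 < L) (f : Site L n₁ → E) :
    ipS f f = ipS (Rop L f) (Rop L f) + ipS (Pop L f) (Pop L f) := by
  have e : f = Rop L f + Pop L f := by rw [Rop_apply, Pop_apply, sub_add_cancel]
  conv_lhs => rw [e]
  rw [ipS_add_add, ipS_Rop_Pop hL, mul_zero, add_zero]

/-- `⟨Rf,Rf⟩ ≤ ⟨f,f⟩`. [cite: DybalskiStottmeisterTanimoto2024, §2.1 (2.6)] -/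
theorem ipS_Rop_Rop_le (hL : 0 < L) (f : Site L n₁ → E) : ipS (Rop L f) (Rop L f) ≤ ipS f f := by
  rw [ipS_eq_Rop_add_Pop hL f]; linarith [ipS_self_nonneg (Pop L f)]

/-- `R` is symmetric: `⟨f, Rh⟩ = ⟨Rf, h⟩`. [cite: DybalskiStottmeisterTanimoto2024, §2.1 (2.6)] -/
theorem ipS_Rop_comm (hL : 0 < L) (f h : Site L n₁ → E) : ipS f (Rop L h) = ipS (Rop L f) h := by
  rw [Rop_apply, Rop_apply, ipS_sub_right, ipS_sub_left, ipS_Qstar_Q_symm hL]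

/-- `⟨∂*∂g, ∂*∂g⟩ ≤ 64⟨g,g⟩`. [cite: DybalskiStottmeisterTanimoto2024, §4.2 (bounded-Laplacian)] -/
theorem ipS_Aop_Aop_le (g : Site L n₁ → E) : ipS (Aop g : Site L n₁ → E) (Aop g) ≤ 64 * ipS g g := by
  rw [Aop_apply]
  exact (ipS_delStar_le (del g)).trans (by nlinarith [ipB_del_le g])

/-- **Box Poincaré on `ker Q`**: `⟨g,g⟩ ≤ 8L⁴⟨∂g,∂g⟩` when `Qg = 0` ((unit-box) summed over the boxes, dropping the inter-box bonds).
[cite: DybalskiStottmeisterTanimoto2024, §4.2 Lemma (inverse-lemma) 1. (unit-box), proof of 2.] -/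
theorem ipS_le_of_Q_eq_zero (hL : 0 < L) {g : Site L n₁ → E} (hg : Q L g = 0) :
    ipS g g ≤ 8 * (L : ℝ) ^ 4 * ipB (del g) (del g) := by
  rw [ipS_self, sum_eq_sum_box]
  calc ∑ y, ∑ x ∈ box L y, ‖g x‖ ^ 2 ≤ ∑ y, 8 * (L : ℝ) ^ 4 * Sbox g y := Finset.sum_le_sum fun y _ => by
          have h := unit_box hL g y
          rw [hg, Pi.zero_apply, norm_zero] at h
          simpa using h
    _ = 8 * (L : ℝ) ^ 4 * ∑ y, Sbox g y := by rw [Finset.mul_sum]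
    _ ≤ 8 * (L : ℝ) ^ 4 * ipB (del g) (del g) := mul_le_mul_of_nonneg_left (sum_Sbox_le g) (by positivity)

/-- **Coercivity of `K`**: `(8L⁴)⁻¹⟨f,f⟩ ≤ ⟨f,Kf⟩` (`⟨f,Kf⟩ = ⟨∂Rf, ∂Rf⟩ + ⟨Pf,Pf⟩`, box Poincaré on `Rf ∈ ker Q`, Pythagoras).
[cite: DybalskiStottmeisterTanimoto2024, §4.2 Lemma (inverse-lemma) 1.–2.; §4.5 Lemma (infty-bounds)] -/
theorem ipS_Kop_ge (hL : 0 < L) (f : Site L n₁ → E) : (8 * (L : ℝ) ^ 4)⁻¹ * ipS f f ≤ ipS f (Kop L f) := by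
  have hL8 : (0 : ℝ) < 8 * (L : ℝ) ^ 4 := by positivity
  have e1 : ipS f (Kop L f) = ipB (del (Rop L f)) (del (Rop L f)) + ipS (Pop L f) (Pop L f) := by
    rw [Kop_apply, ipS_add_right, ipS_Rop_comm hL, Aop_apply, ← ipB_del, ipS_Pop_Pop hL]
  have h1 := ipS_le_of_Q_eq_zero hL (Q_Rop hL f)
  have h2 : (8 * (L : ℝ) ^ 4)⁻¹ * ipS (Rop L f) (Rop L f) ≤ ipB (del (Rop L f)) (del (Rop L f)) := by
    rw [inv_mul_le_iff₀ hL8]; exact h1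
  have h3 : (8 * (L : ℝ) ^ 4)⁻¹ ≤ 1 := by
    apply inv_le_one_of_one_le₀
    have : (1 : ℝ) ≤ (L : ℝ) ^ 4 := one_le_pow₀ (by exact_mod_cast hL)
    linarith
  have h4 := ipS_self_nonneg (Pop L f)
  rw [e1, ipS_eq_Rop_add_Pop hL f, mul_add]
  nlinarith

/-- **Boundedness of `K`**: `⟨Kf,Kf⟩ ≤ 130⟨f,f⟩`. [cite: DybalskiStottmeisterTanimoto2024, §4.2 (bounded-Laplacian); §4.5 Lemma (infty-bounds)] -/
theorem ipS_Kop_Kop_le (hL : 0 < L) (f : Site L n₁ → E) : ipS (Kop L f) (Kop L f) ≤ 130 * ipS f f := by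
  rw [Kop_apply]
  have h1 := ipS_add_add_le (Rop L (Aop (Rop L f))) (Pop L f)
  have h2 : ipS (Rop L (Aop (Rop L f))) (Rop L (Aop (Rop L f))) ≤ 64 * ipS f f :=
    calc ipS (Rop L (Aop (Rop L f))) (Rop L (Aop (Rop L f))) ≤ ipS (Aop (Rop L f) : Site L n₁ → E) (Aop (Rop L f)) :=
          ipS_Rop_Rop_le hL _
      _ ≤ 64 * ipS (Rop L f) (Rop L f) := ipS_Aop_Aop_le _
      _ ≤ 64 * ipS f f := mul_le_mul_of_nonneg_left (ipS_Rop_Rop_le hL f) (by norm_num)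
  have h3 : ipS (Pop L f) (Pop L f) ≤ ipS f f := ipS_QstarQ_le hL f
  linarith

/-- Coercivity of `−Δ_Ω + Q*Q` in the form used by the transfer theorem. [cite: DybalskiStottmeisterTanimoto2024, §4.2 Lemma (inverse-lemma) 2. (many-boxes)] -/
theorem ipS_Mop_ge (hL : 0 < L) (f : Site L n₁ → E) : (8 * (L : ℝ) ^ 4)⁻¹ * ipS f f ≤ ipS f (Mop L f) := by
  rw [inv_mul_le_iff₀ (by positivity), Mop_apply]; exact many_boxes hL f

/-! ## First bound of Lemma (infty-bounds): `‖Γ‖_{∞,∞;Ω} ≤ C_Γ(L)` -/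

/-- The constant `C_Γ(L) = supConst L (8L⁴)⁻¹ 130 1` (`= 12·130·512·L¹³`; «`C ∼ L⁴`» is Remark 4.2's sharper count, not needed).
[cite: DybalskiStottmeisterTanimoto2024, §4.5 Lemma (infty-bounds); Remark 4.2] -/
def CGamma (L : ℕ) : ℝ := supConst L (8 * (L : ℝ) ^ 4)⁻¹ 130 1

/-- [cite: DybalskiStottmeisterTanimoto2024, §4.5 Lemma (infty-bounds)] -/
theorem CGamma_nonneg (L : ℕ) : 0 ≤ CGamma L := supConst_nonneg L (by positivity) (by norm_num) 1

/-- `((8L⁴)⁻¹)² ≤ 130`. [cite: DybalskiStottmeisterTanimoto2024, §4.2] -/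
theorem sigma_sq_le (hL : 0 < L) : ((8 * (L : ℝ) ^ 4)⁻¹) ^ 2 ≤ 130 := by
  have h3 : (8 * (L : ℝ) ^ 4)⁻¹ ≤ 1 := by
    apply inv_le_one_of_one_le₀
    have : (1 : ℝ) ≤ (L : ℝ) ^ 4 := one_le_pow₀ (by exact_mod_cast hL)
    linarith
  have h0 : 0 ≤ (8 * (L : ℝ) ^ 4)⁻¹ := by positivity
  nlinarith

variable [FiniteDimensional ℝ E]

/-- **Lemma (infty-bounds), first bound: `‖Γf‖_{∞;Ω} ≤ C_Γ(L)‖f‖_{∞;Ω}`, uniformly in `n₁`.**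
[cite: DybalskiStottmeisterTanimoto2024, §4.5 Lemma (infty-bounds) («`‖Γ‖_{∞,∞;Ω} ≤ C`»)] -/
theorem norm_Gamma_le (hL : 0 < L) (f : Site L n₁ → E) : ‖Gamma hL f‖ ≤ CGamma L * ‖f‖ :=
  norm_le_of_apply_eq (M := Mop L) (by positivity) (sigma_sq_le hL) (ipS_Mop_ge hL) (ipS_Mfun_Mfun_le hL) (hasRange_Mop hL)
    (u := Gamma hL f) (Mfun_Gamma hL f)

/-! ## The auxiliary inverse `K⁻¹` -/

omit [FiniteDimensional ℝ E] in
/-- `K` is injective (coercivity). [cite: DybalskiStottmeisterTanimoto2024, §4.5 Lemma (infty-bounds)] -/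
theorem Kop_injective (hL : 0 < L) : Function.Injective (Kop L : (Site L n₁ → E) →ₗ[ℝ] (Site L n₁ → E)) := by
  intro f g h
  have h0 : Kop L (f - g) = 0 := by rw [map_sub, h, sub_self]
  have h1 := ipS_Kop_ge hL (f - g)
  rw [h0] at h1
  have h2 : ipS (f - g) (0 : Site L n₁ → E) = 0 := by unfold ipS; simp
  rw [h2] at h1
  have h3 : ipS (f - g) (f - g) ≤ 0 := by
    have hL8 : (0 : ℝ) < (8 * (L : ℝ) ^ 4)⁻¹ := by positivity
    nlinarith [ipS_self_nonneg (f - g)]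
  apply sub_eq_zero.mp
  funext x
  have hx : ‖(f - g) x‖ ^ 2 ≤ 0 := (norm_apply_sq_le_ipS (f - g) x).trans h3
  have : ‖(f - g) x‖ = 0 := by nlinarith [norm_nonneg ((f - g) x)]
  exact norm_eq_zero.mp this

/-- `K⁻¹`. [cite: DybalskiStottmeisterTanimoto2024, §4.5 Lemma (infty-bounds)] -/
def Kinv (hL : 0 < L) : (Site L n₁ → E) ≃ₗ[ℝ] (Site L n₁ → E) :=
  (LinearEquiv.ofInjectiveEndo (Kop L) (Kop_injective hL)).symm

/-- `K K⁻¹ v = v`. [cite: DybalskiStottmeisterTanimoto2024, §4.5 Lemma (infty-bounds)] -/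
theorem Kop_Kinv (hL : 0 < L) (v : Site L n₁ → E) : Kop L (Kinv hL v) = v := by
  have h := (LinearEquiv.ofInjectiveEndo (Kop L) (Kop_injective (n₁ := n₁) (E := E) hL)).apply_symm_apply v
  rw [LinearEquiv.coe_ofInjectiveEndo] at h
  exact h

/-- `‖K⁻¹v‖_{∞;Ω} ≤ C_Γ(L)‖v‖_{∞;Ω}` (transfer theorem for `K`). [cite: DybalskiStottmeisterTanimoto2024, §4.5 Lemma (infty-bounds)] -/
theorem norm_Kinv_le (hL : 0 < L) (v : Site L n₁ → E) : ‖Kinv hL v‖ ≤ CGamma L * ‖v‖ :=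
  norm_le_of_apply_eq (M := Kop L) (by positivity) (sigma_sq_le hL) (ipS_Kop_ge hL) (ipS_Kop_Kop_le hL) (hasRange_Kop hL)
    (u := Kinv hL v) (Kop_Kinv hL v)

/-! ## Second bound of Lemma (infty-bounds): `‖(QΓQ*)⁻¹‖_{∞,∞;Ω₁} ≤ C_Q(L)` via the Schur complement -/

/-- **The Schur-complement identity**: `(QΓQ*)⁻¹g = g + Q∂*∂(Q*g − K⁻¹R∂*∂Q*g)`.  (With `w = K⁻¹RAQ*g`: `Pw = 0`, `f := Q*g − w` has
`Qf = g` and `(−Δ_Ω + Q*Q)f = Q*(g + QAf)`, so `QΓQ*(g + QAf) = Qf = g`.)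
[cite: DybalskiStottmeisterTanimoto2024, §4.5 Lemma (infty-bounds) («`N = (QΓQ*)⁻¹`»); §4.2 Lemma (inverse-lemma) 3.] -/
theorem QGammaQstar_symm_eq (hL : 0 < L) (g : CSite n₁ → E) :
    (QGammaQstar hL).symm g = g + Q L (Aop (Qstar L g - Kinv hL (Rop L (Aop (Qstar L g))))) := by
  set w : Site L n₁ → E := Kinv hL (Rop L (Aop (Qstar L g))) with hw
  set f : Site L n₁ → E := Qstar L g - w with hf
  have hKw : Kop L w = Rop L (Aop (Qstar L g)) := Kop_Kinv hL _
  -- `Pw = 0`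
  have hPw : Pop L w = 0 := by
    have h := congrArg (Pop L) hKw
    rw [Kop_apply, map_add, Pop_Rop hL, Pop_Rop hL, zero_add, Pop_apply, Pop_apply, Qstar_Q_Qstar_Q hL] at h
    rw [Pop_apply]
    exact h
  have hQw : Q L w = 0 := by
    have h : Q L (Pop L w) = Q L w := by rw [Pop_apply, Q_Qstar hL]
    rw [← h, hPw]
    funext y; rw [Q_apply]; simp
  have hRw : Rop L w = w := by rw [Rop_apply, ← Pop_apply, hPw, sub_zero]
  -- `RAf = 0`, i.e. `Af = P(Af)`
  have hRAf : Rop L (Aop f) = 0 := by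
    rw [hf, map_sub, map_sub]
    have h := hKw
    rw [Kop_apply, hPw, add_zero, hRw] at h
    rw [h, sub_self]
  have hAf : (Aop f : Site L n₁ → E) = Pop L (Aop f) := by
    have h := hRAf
    rw [Rop_apply] at h
    exact (sub_eq_zero.mp h)
  -- `(−Δ_Ω + Q*Q)f = Q*(g + QAf)`
  have hM : Mfun L f = Qstar L (g + Q L (Aop f)) := by
    have e1 : Mfun L f = Aop f + Pop L f := rfl
    have e2 : Pop L f = Qstar L g := by
      rw [Pop_apply, hf, Q_sub, Q_Qstar hL, hQw, sub_zero]
    rw [e1, e2, Qstar_add, add_comm]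
    congr 1
  have hQf : Q L f = g := by rw [hf, Q_sub, Q_Qstar hL, hQw, sub_zero]
  rw [LinearEquiv.symm_apply_eq, QGammaQstar_apply, ← hM, Gamma_Mfun hL, hQf]

/-- The constant `C_Q(L) = 9 + 128·C_Γ(L)`. [cite: DybalskiStottmeisterTanimoto2024, §4.5 Lemma (infty-bounds)] -/
def CQinv (L : ℕ) : ℝ := 9 + 128 * CGamma L

/-- **Lemma (infty-bounds), second bound: `‖(QΓQ*)⁻¹g‖_{∞;Ω₁} ≤ C_Q(L)‖g‖_{∞;Ω₁}`, uniformly in `n₁`.**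
[cite: DybalskiStottmeisterTanimoto2024, §4.5 Lemma (infty-bounds) («`‖(QΓQ*)⁻¹‖_{∞,∞;Ω₁} ≤ C`»)] -/
theorem norm_QGammaQstar_symm_le (hL : 0 < L) (g : CSite n₁ → E) : ‖(QGammaQstar hL).symm g‖ ≤ CQinv L * ‖g‖ := by
  rw [QGammaQstar_symm_eq hL g]
  have hC := CGamma_nonneg L
  set w : Site L n₁ → E := Kinv hL (Rop L (Aop (Qstar L g))) with hw
  have hw' : ‖w‖ ≤ 16 * CGamma L * ‖g‖ :=
    calc ‖w‖ ≤ CGamma L * ‖(Rop L (Aop (Qstar L g)) : Site L n₁ → E)‖ := norm_Kinv_le hL _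
      _ ≤ CGamma L * (2 * (8 * ‖Qstar L g‖)) := by
          refine mul_le_mul_of_nonneg_left ((norm_Rop_le hL _).trans ?_) hC
          exact mul_le_mul_of_nonneg_left (norm_Aop_le _) (by norm_num)
      _ ≤ CGamma L * (2 * (8 * ‖g‖)) := by gcongr; exact norm_Qstar_le g
      _ = 16 * CGamma L * ‖g‖ := by ring
  have hf : ‖Qstar L g - w‖ ≤ (1 + 16 * CGamma L) * ‖g‖ :=
    calc ‖Qstar L g - w‖ ≤ ‖Qstar L g‖ + ‖w‖ := norm_sub_le _ _
      _ ≤ ‖g‖ + 16 * CGamma L * ‖g‖ := add_le_add (norm_Qstar_le g) hw'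
      _ = (1 + 16 * CGamma L) * ‖g‖ := by ring
  calc ‖g + Q L (Aop (Qstar L g - w))‖ ≤ ‖g‖ + ‖Q L (Aop (Qstar L g - w))‖ := norm_add_le _ _
    _ ≤ ‖g‖ + 8 * ((1 + 16 * CGamma L) * ‖g‖) := by
        refine add_le_add le_rfl ((norm_Q_le hL _).trans ((norm_Aop_le _).trans ?_))
        exact mul_le_mul_of_nonneg_left hf (by norm_num)
    _ = CQinv L * ‖g‖ := by rw [CQinv]; ring

/-- **Lemma (infty-bounds)** as printed: «The following bounds hold true: `‖Γ‖_{∞,∞;Ω} ≤ C`, `‖(QΓQ*)⁻¹‖_{∞,∞;Ω₁} ≤ C`, for `C`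
independent of `n`.» — here with the explicit `C = max(C_Γ(L), C_Q(L))`-free form: both bounds with their own constants, for every
volume `n₁` and every finite-dimensional real inner-product fibre `E` (print: `E = ℝ³`).
[cite: DybalskiStottmeisterTanimoto2024, §4.5 Lemma (infty-bounds)] -/
theorem infty_bounds (hL : 0 < L) :
    (∀ {n₁ : ℕ} (f : Site L n₁ → E), ‖Gamma hL f‖ ≤ CGamma L * ‖f‖) ∧
      ∀ {n₁ : ℕ} (g : CSite n₁ → E), ‖(QGammaQstar hL).symm g‖ ≤ CQinv L * ‖g‖ :=
  ⟨fun f => norm_Gamma_le hL f, fun g => norm_QGammaQstar_symm_le hL g⟩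

end Operators

/-! ## THEOREM 1 -/

/-- **THEOREM 1 of [DybalskiStottmeisterTanimoto2024] (§1.1), PROVED**: *«Let `G₀ = SU(2)`. Then there exist `0 < ε, ε₁ ≤ 1` such that
for `V ∈ Conf_{ε₁}(Ω₁)` the action `𝒜` has a unique critical point over `Conf_ε(Ω)` with the constraint `𝒞(U) = V`. The parameters
`ε, ε₁` are independent of `n` but may depend on `L`.»*  The discharge of the typed statement `DST24Setting.Theorem1 L` (for every `L`;
the statement carries its own hypotheses `Odd L`, `1 < L`): Lemma (infty-bounds) of this file fed into
`DST24MainTheorem.theorem1_of_infty_bounds` (§§2–4 of the paper, p12 gen 7).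
[cite: DybalskiStottmeisterTanimoto2024, Theorem 1 §1.1; §4.7 «The main result»] -/
theorem Theorem1_holds (L : ℕ) : Theorem1 L := fun hodd h1 =>
  theorem1_of_infty_bounds (lt_trans zero_lt_one h1) (fun f => norm_Gamma_le _ f)
    (fun g => norm_QGammaQstar_symm_le _ g) hodd h1

end

end Literature.MathematicalPhysics.QuantumFieldTheory.DybalskiStottmeisterTanimoto2024.DST24InftyBounds
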